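import Literature.Probability.RandomPlanarGeometry.EllipseHulls
import Literature.Probability.RandomPlanarGeometry.ConformalRestrictionProofs
import HarnessLib

/-!
# Stretch rigidity of SLE(8/3), part 1: the wide half-ellipse hulls in axis coordinates

Helper file of the lead's assembly of `stub_stretchRigidity` (line `pin-the-shear`, crux
stmt-CriticalPhenomena-14221; item stmt-CriticalPhenomena-5793 `StretchRigidity`).

The tree's half-ellipse hulls `ellHull a b ρ` (foci `a < b`, Joukowski parameter `ρ`) centred at
`1` with horizontal semi-axis `α` and vertical semi-axis `β` (`0 < β < α < 1`) have foci
`1 ∓ f`, `f = √(α² - β²)`, and parameter `ρ = √((α - β)/(α + β))`. This file records the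
elementary identities behind that reparametrisation (`ρ + ρ⁻¹ = 2α/f`, `ρ⁻¹ - ρ = 2β/f`,
`ellC = 1`, `ellH = f/2`, the positivity condition `h · jLevel ρ < c`), the preimage of the
axis-form half-ellipse under an axis stretch `(x, y) ↦ (x, s y)` and under a dilation, and the
pull-back of the avoidance event `{range ⊆ (ε K)ᶜ}` along `CurveClass.map`.
-/

noncomputable section

namespace Summit.CriticalPhenomena.SAWScalingLimit.Cruxes.HexTransfer.PinTheShear

open Set Filter Topology
open Literature.Probability.RandomPlanarGeometry

/-! ### The focal parameter `f = √(α² - β²)` and the Joukowski parameter `ρ = √((α-β)/(α+β))` -/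

/-- For `0 < β < α`: `f = √(α² - β²)` satisfies `0 < f`, `f < α`, `f² = α² - β²` and
`f = √(α - β) · √(α + β)`. [folklore] -/
theorem focal_data {α β : ℝ} (hβ : 0 < β) (hβα : β < α) :
    0 < Real.sqrt (α ^ 2 - β ^ 2) ∧ Real.sqrt (α ^ 2 - β ^ 2) < α ∧
      Real.sqrt (α ^ 2 - β ^ 2) ^ 2 = α ^ 2 - β ^ 2 ∧
      Real.sqrt (α ^ 2 - β ^ 2) = Real.sqrt (α - β) * Real.sqrt (α + β) := by
  have hα : 0 < α := hβ.trans hβα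
  have hpos : 0 < α ^ 2 - β ^ 2 := by nlinarith
  refine ⟨Real.sqrt_pos.2 hpos, ?_, Real.sq_sqrt hpos.le, ?_⟩
  · rw [Real.sqrt_lt' hα]
    nlinarith
  · rw [← Real.sqrt_mul (by linarith : (0 : ℝ) ≤ α - β)]
    congr 1
    ring

/-- For `0 < β < α`: `ρ = √((α-β)/(α+β))` satisfies `0 < ρ < 1`, `ρ + ρ⁻¹ = 2α/f` and
`ρ⁻¹ - ρ = 2β/f` with `f = √(α² - β²)`. [folklore] -/
theorem rho_data {α β : ℝ} (hβ : 0 < β) (hβα : β < α) :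
    0 < Real.sqrt ((α - β) / (α + β)) ∧ Real.sqrt ((α - β) / (α + β)) < 1 ∧
      Real.sqrt ((α - β) / (α + β)) + (Real.sqrt ((α - β) / (α + β)))⁻¹ =
        2 * α / Real.sqrt (α ^ 2 - β ^ 2) ∧
      (Real.sqrt ((α - β) / (α + β)))⁻¹ - Real.sqrt ((α - β) / (α + β)) =
        2 * β / Real.sqrt (α ^ 2 - β ^ 2) := by
  have hα : 0 < α := hβ.trans hβα
  have hu : 0 < α - β := by linarith
  have hv : 0 < α + β := by linarith
  set u := Real.sqrt (α - β) with hu_def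
  set v := Real.sqrt (α + β) with hv_def
  have hu0 : 0 < u := Real.sqrt_pos.2 hu
  have hv0 : 0 < v := Real.sqrt_pos.2 hv
  have hu2 : u ^ 2 = α - β := Real.sq_sqrt hu.le
  have hv2 : v ^ 2 = α + β := Real.sq_sqrt hv.le
  have hρ : Real.sqrt ((α - β) / (α + β)) = u / v := by
    rw [hu_def, hv_def, ← Real.sqrt_div' _ hv.le]
  have hf : Real.sqrt (α ^ 2 - β ^ 2) = u * v := (focal_data hβ hβα).2.2.2
  rw [hρ, hf]
  refine ⟨div_pos hu0 hv0, ?_, ?_, ?_⟩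
  · rw [div_lt_one hv0, hu_def, hv_def]
    exact Real.sqrt_lt_sqrt hu.le (by linarith)
  · rw [inv_div]
    field_simp
    nlinarith [hu2, hv2]
  · rw [inv_div]
    field_simp
    nlinarith [hu2, hv2]

/-- Centre and scale of the foci `1 ∓ f`: `ellC = 1`, `ellH = f/2`. [folklore] -/
theorem ellC_ellH_foci (f : ℝ) : ellC (1 - f) (1 + f) = 1 ∧ ellH (1 - f) (1 + f) = f / 2 := by
  rw [ellC, ellH]
  constructor <;> ring

/-- The semi-axes of `ellHull (1-f) (1+f) ρ` for the `(α, β)` parametrisation are `α` and `β`,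
and the positivity condition `h · jLevel ρ < c` is `α < 1`. [folklore] -/
theorem axes_data {α β : ℝ} (hβ : 0 < β) (hβα : β < α) (hα1 : α < 1) :
    ellH (1 - Real.sqrt (α ^ 2 - β ^ 2)) (1 + Real.sqrt (α ^ 2 - β ^ 2)) *
        (Real.sqrt ((α - β) / (α + β)) + (Real.sqrt ((α - β) / (α + β)))⁻¹) = α ∧
      ellH (1 - Real.sqrt (α ^ 2 - β ^ 2)) (1 + Real.sqrt (α ^ 2 - β ^ 2)) *
        ((Real.sqrt ((α - β) / (α + β)))⁻¹ - Real.sqrt ((α - β) / (α + β))) = β ∧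
      ellH (1 - Real.sqrt (α ^ 2 - β ^ 2)) (1 + Real.sqrt (α ^ 2 - β ^ 2)) *
          jLevel (Real.sqrt ((α - β) / (α + β))) <
        ellC (1 - Real.sqrt (α ^ 2 - β ^ 2)) (1 + Real.sqrt (α ^ 2 - β ^ 2)) := by
  obtain ⟨hf0, -, -, -⟩ := focal_data hβ hβα
  obtain ⟨-, -, hsum, hdiff⟩ := rho_data hβ hβα
  obtain ⟨hC, hH⟩ := ellC_ellH_foci (Real.sqrt (α ^ 2 - β ^ 2))
  have h1 : ellH (1 - Real.sqrt (α ^ 2 - β ^ 2)) (1 + Real.sqrt (α ^ 2 - β ^ 2)) *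
      (Real.sqrt ((α - β) / (α + β)) + (Real.sqrt ((α - β) / (α + β)))⁻¹) = α := by
    rw [hH, hsum]
    field_simp
  refine ⟨h1, ?_, ?_⟩
  · rw [hH, hdiff]
    field_simp
  · rw [jLevel, h1, hC]
    exact hα1

/-! ### The axis-form half-ellipse and its preimages -/

/-- Preimage of the axis-form half-ellipse with semi-axes `(α, s β)` under the axis stretch
`(x, y) ↦ (x, s y)` followed by the dilation by `ε`: the dilated half-ellipse with semi-axes
`(α, β)`. [folklore] -/
theorem stretch_preimage_ell {s ε α β : ℝ} (hs : 0 < s) (hβ : 0 < β)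
    (Ψ : ℂ ≃ₜ ℂ) (hΨ : ∀ z : ℂ, Ψ z = (z.re : ℂ) + ((s * z.im : ℝ) : ℂ) * Complex.I) :
    Ψ ⁻¹' ((fun z : ℂ => (ε : ℂ) * z) ''
        {z : ℂ | 0 ≤ z.im ∧ ((z.re - 1) / α) ^ 2 + (z.im / (s * β)) ^ 2 ≤ 1}) =
      (fun z : ℂ => (ε : ℂ) * z) ''
        {z : ℂ | 0 ≤ z.im ∧ ((z.re - 1) / α) ^ 2 + (z.im / β) ^ 2 ≤ 1} := by
  have hre : ∀ z : ℂ, (Ψ z).re = z.re := fun z => by simp [hΨ z]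
  have him : ∀ z : ℂ, (Ψ z).im = s * z.im := fun z => by simp [hΨ z]
  have hsβ : s * β ≠ 0 := (mul_pos hs hβ).ne'
  ext z
  simp only [mem_preimage, mem_image, mem_setOf_eq]
  constructor
  · rintro ⟨w, ⟨hw0, hw1⟩, hw⟩
    -- `Ψ z = ε w`, so `z = ε w'` with `w' = (w.re, w.im / s)`
    refine ⟨⟨w.re, w.im / s⟩, ⟨?_, ?_⟩, ?_⟩
    · exact div_nonneg hw0 hs.le
    · have : w.im / s / β = w.im / (s * β) := by rw [div_div, mul_comm]
      simpa [this] using hw1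
    · apply Complex.ext
      · have h := congrArg Complex.re hw
        rw [hre] at h
        simp at h ⊢
        linarith
      · have h := congrArg Complex.im hw
        rw [him] at h
        simp at h ⊢
        field_simp
        linarith
  · rintro ⟨w, ⟨hw0, hw1⟩, rfl⟩
    refine ⟨⟨w.re, s * w.im⟩, ⟨?_, ?_⟩, ?_⟩
    · exact mul_nonneg hs.le hw0
    · have : s * w.im / (s * β) = w.im / β := by field_simp
      simpa [this] using hw1
    · apply Complex.ext
      · rw [hre]; simp
      · rw [him]; simp; ring

/-- Pull-back of the avoidance event along `CurveClass.map`: a class avoids `Ψ⁻¹ T` iff its image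
avoids `T`. [folklore] -/
theorem preimage_map_rangeSubset_compl :
    ∀ (Ψ : ℂ ≃ₜ ℂ) (T : Set ℂ), CurveClass.map (Ψ : C(ℂ, ℂ)) ⁻¹' CurveClass.rangeSubset Tᶜ = CurveClass.rangeSubset (Ψ ⁻¹' T)ᶜ := by
  intro Ψ T
  ext c
  simp only [mem_preimage, CurveClass.mem_rangeSubset, CurveClass.range_map, image_subset_iff,
    preimage_compl]
  exact Iff.rfl

/-- The axis-form half-ellipse lies in the closed upper half-plane and is compact. [folklore] -/
theorem ell_axis_compact_subset {α β : ℝ} (hα : 0 < α) (hβ : 0 < β) :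
    IsCompact {z : ℂ | 0 ≤ z.im ∧ ((z.re - 1) / α) ^ 2 + (z.im / β) ^ 2 ≤ 1} ∧
      {z : ℂ | 0 ≤ z.im ∧ ((z.re - 1) / α) ^ 2 + (z.im / β) ^ 2 ≤ 1} ⊆
        closure UpperHalfPlane.upperHalfPlaneSet := by
  constructor
  · refine Metric.isCompact_of_isClosed_isBounded ?_ ?_
    · refine (isClosed_le continuous_const Complex.continuous_im).inter ?_
      have hc : Continuous fun z : ℂ => ((z.re - 1) / α) ^ 2 + (z.im / β) ^ 2 := by fun_prop
      exact isClosed_le hc continuous_const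
    · refine (Metric.isBounded_closedBall (x := (1 : ℂ)) (r := α + β)).subset ?_
      rintro z ⟨-, hz⟩
      rw [Metric.mem_closedBall, Complex.dist_eq, Complex.norm_def, Real.sqrt_le_left (by positivity),
        Complex.normSq_apply]
      have h1 : ((z.re - 1) / α) ^ 2 ≤ 1 := by nlinarith [sq_nonneg (z.im / β)]
      have h2 : (z.im / β) ^ 2 ≤ 1 := by nlinarith [sq_nonneg ((z.re - 1) / α)]
      have h1' : (z.re - 1) ^ 2 ≤ α ^ 2 := by
        rw [div_pow, div_le_one (by positivity)] at h1; exact h1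
      have h2' : z.im ^ 2 ≤ β ^ 2 := by
        rw [div_pow, div_le_one (by positivity)] at h2; exact h2
      have h3 : |z.re - 1| ≤ α := abs_le_of_sq_le_sq' h1' hα.le |>.elim (fun h h' => abs_le.2 ⟨h, h'⟩)
      have h4 : |z.im| ≤ β := abs_le_of_sq_le_sq' h2' hβ.le |>.elim (fun h h' => abs_le.2 ⟨h, h'⟩)
      simp only [Complex.sub_re, Complex.one_re, Complex.sub_im, Complex.one_im, sub_zero]
      nlinarith [abs_nonneg (z.re - 1), abs_nonneg z.im, sq_abs (z.re - 1), sq_abs z.im]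
  · rw [show closure UpperHalfPlane.upperHalfPlaneSet = {z : ℂ | 0 ≤ z.im} from
      Complex.closure_setOf_lt_im 0]
    exact fun z hz => hz.1

end Summit.CriticalPhenomena.SAWScalingLimit.Cruxes.HexTransfer.PinTheShear

end
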